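import Literature.IUT.HodgeArakelov.BadPlaceSettingAtModelTate
import Literature.IUT.HodgeArakelov.ThetaEvaluationSettingAtModelTateOfExtends
import Literature.IUT.HodgeArakelov.ThetaSettingHcharYOfParityAtModelTate
import HarnessLib

/-!
# [IUTchII] Prop. 2.1 at the Tate model of record with (H1) SUPPLIED in kernel — K4 re-close of cone node `IUTchII:Prop2.1`

S. Mochizuki, *Inter-universal Teichmüller theory II*, kurims manuscript (Dec. 2020) §2, Prop. 2.1 p. 65 («may be
reconstructed … from `Π^tp_{X̲̲_v}`»; claim key `Mochizuki2012`, DISPUTED, D-0012) [claim: Mochizuki2012, status: disputed]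
(IUTchII §2 Prop 2.1, kurims p.65); S. Mochizuki, *The étale theta function …* [EtTh], Publ. RIMS **45** (2009), Prop. 2.4 (i)
p. 38 (every automorphism of `Π^tp_{X̲̲}` extends to `Π^tp_X`) [cite: MochizukiEtTh2009, Prop 2.4 p.38].

PROOF-ONLY companion (cell abc-iut, seat abc-iut-f-095 gen 12, row «K4B6», director-abc KEY 2026-08-27T07:16:54Z; NO
definition, NO instance, NO new named fact; inputs consumed BY NAME).  CONTEXT (abc-iut-c312-2 `CONE-K4-RECLOSE.tsv` v4):
node `IUTchII:Prop2.1` is K4 class BLOCKED because two of its four closers (`TemperedCoverings.YL_eq_of_prop24`,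
`BadPlaceSetting.isTopCharacteristic_refY_refYdd_of_prop24`) bind the named fact `TemperedCoverData.Prop24` (F-0609:
`∀`-closure REFUTED p435476, instance at the `κ′` datum of record REFUTED p475371, 0 producers), while the other two
(`YL_eq_of_piYddCharacteristic`, `YL_eq_of_cor218_i`) bind (H1) `PiYddCharacteristic` (F-2633) / `Cor218_i` (F-0620).
abc-iut-w5-d233's `ModelTateCarriers.YL_eq_of_piYddCharacteristic_modelTate` (p453435) is the node's conclusion at the
[EtTh] Tate model of record MODULO (H1) at the instance; abc-iut-w5-d169's
`SettingModel.piYddCharacteristic_modelχq_of_extends` (p492265) and abc-iut-w6-d055's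
`ModelTateCarriers.piYddCharacteristic_modelχq_of_parity` (p495340) SUPPLY (H1) at every stage-2 model datum from the
[EtTh] Prop. 2.4 (i)-shaped extension property `hextΔ`, resp. from the level-2 parity law `L_Ÿ♯`.

THIS FILE composes them: the node's conclusion «any two Prop. 2.1 outputs over the bad-place setting of the Tate model have
the same top row `Π^tp_{Ÿ̲_v} ⊆ Π^tp_{Y̲_v}`» with displayed `Prop` binder `hextΔ` ONLY (`YL_eq_modelTate_of_extends`),
resp. `L_Ÿ♯` ONLY (`YL_eq_modelTate_of_parity`) — NO F-0609 / F-2633 / F-0620 / F-0591 binder.  `hextΔ` itself is NOT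
decided at the model by any tree theorem (abc-iut-L6-d6 memo COR218I-AT-MODELTATE; abc-iut-L2-t2 g13 liaison «NONE
DECISIVE»): a re-keying upstream in print, not a net discharge.

HONEST LABEL: `modelχq` / `modelTate` is a SEMI-SYNTHETIC model of the typed [EtTh] §1 interface (not the tempered `π₁` of a
curve); CONDITIONAL-AT-MODEL on the displayed binder; nothing of [IUTchII] or [EtTh] is asserted; no side taken on
[IUTchIII] Cor. 3.12; typed ≠ proved; instantiated ≠ endorsed; nothing here says abc is proved or refuted.  Axioms standard.
-/

noncomputable section

namespace Literature.IUT.HodgeArakelov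

open Literature.AnabelianGeometry.EtaleTheta Literature.AnabelianGeometry.SemiGraphs
open Literature.AnabelianGeometry.EtaleTheta.SettingModel
open scoped Literature.AnabelianGeometry.EtaleTheta

namespace ModelTateCarriers

variable (p : ℕ) [Fact p.Prime] (l : ℕ+) (hl : Odd (l : ℕ)) (hlp : (l : ℕ).Prime) (hdvd : 4 * (l : ℕ) ∣ p - 1) {N : ℕ+}
  (μ : (ThetaSetting.modelχq p 1 2 even_two).CyclotomeMod l N)

/-- **[IUTchII] Prop. 2.1 well-definedness AT THE TATE MODEL OF RECORD, (H1) supplied from `hextΔ`** (K4 re-close of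
`IUTchII:Prop2.1`): over the bad-place setting of record (`modelTate p`, Galois factor `inr`, class `η̈♯ = etaDdχq`,
`X̲̲ := doubleUnderlineχqOfEtaRes`, odd prime `l` with `4l ∣ p − 1`, a level and a cyclotome identification `μ`), if every
bi-continuous automorphism of `Π^tp_{X̲̲}` extends to a `Δ^tp_X`-stabilising bi-continuous automorphism of `Π^tp_X`
(`hextΔ`, the [EtTh] Prop. 2.4 (i) shape), then any two Prop. 2.1 outputs over the same topological group have the same
`Π^tp_{Y̲_v}` AND the same `Π^tp_{Ÿ̲_v}` — abc-iut-w5-d233's closer `YL_eq_of_piYddCharacteristic_modelTate` with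
`hH1 := piYddCharacteristic_modelχq_of_extends …` (abc-iut-w5-d169).  Displayed `Prop` binder: `hextΔ` only.
CONDITIONAL-AT-MODEL. [claim: Mochizuki2012, status: disputed] (IUTchII §2 Prop 2.1, kurims p.65) -/
theorem YL_eq_modelTate_of_extends :
    let C := (((kummerCoreχq p 1 2 even_two).toKummerDataOfSection SemidirectProduct.inr (continuous_inrχq p 1 2)
        (fun _ => rfl) (map_inr_GK_le_GtpY_modelχq' p 1 2 even_two)
        (map_inr_GKdd_le_GtpYdd_modelχq' p 1 2 even_two)).etaleThetaDataOfClass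
        (etaDdχq p 1 2 even_two)).doubleUnderlineχqOfEtaRes p 1 2 l hl (eta_res_etaDdχq p 1 2 even_two l hl)
    let B := BadPlaceSetting.ofUnderline C μ (compat_modelχq p 1 2 even_two)
        (ThetaSetting.modelχq_sec2Hyps p 1 2 even_two) hlp (ne_two_of_four_mul_dvd_pred p l.pos hdvd)
        (ne_of_four_mul_dvd_pred p l.pos hdvd) (exists_isPrimitiveRoot_K_modelχq p 1 2 even_two l.pos hdvd)
        (EtaleThetaDataOfSetting.modN_rootLift_mem_thetaCocycles C (compat_modelχq p 1 2 even_two)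
          (ThetaSetting.modelχq_sec2Hyps p 1 2 even_two) μ)
    (∀ γ : ↥C.Huu ≃ₜ* ↥C.Huu, ∃ Γ : PiTpχq p 1 2 ≃ₜ* PiTpχq p 1 2,
      (∀ h : C.Huu, Γ (h : PiTpχq p 1 2) = ((γ h : C.Huu) : PiTpχq p 1 2)) ∧
        (curveχq p 1 2).DeltaTemp.map Γ.toMulEquiv.toMonoidHom = (curveχq p 1 2).DeltaTemp) →
      ∀ {P : TopGroup.{0}} (T₁ T₂ : TemperedCoverings B P), T₁.YL = T₂.YL ∧ T₁.YddL = T₂.YddL := by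
  intro C B hext P T₁ T₂
  exact YL_eq_of_piYddCharacteristic_modelTate p l hl hlp hdvd μ
    (piYddCharacteristic_modelχq_of_extends p 1 C hext) T₁ T₂

/-- **[IUTchII] Prop. 2.1 well-definedness AT THE TATE MODEL OF RECORD, (H1) supplied from the level-2 parity law
`L_Ÿ♯`** (K4 re-close of `IUTchII:Prop2.1`, second supply): if every bi-continuous automorphism of `Π^tp_{X̲̲}` preserves the
level-`2` `y`-parity on the degree-`0` part (abc-iut-w5-d145's `L_Ÿ♯`, COMPUTATION-CERTIFIED at the record instance, kit
j266770 — computed ≠ proved), then any two Prop. 2.1 outputs over the same topological group have the same top row —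
`YL_eq_of_piYddCharacteristic_modelTate` with `hH1 := piYddCharacteristic_modelχq_of_parity …` (abc-iut-w6-d055).
Displayed `Prop` binder: `L_Ÿ♯` only.  CONDITIONAL-AT-MODEL. [claim: Mochizuki2012, status: disputed]
(IUTchII §2 Prop 2.1, kurims p.65) -/
theorem YL_eq_modelTate_of_parity :
    let C := (((kummerCoreχq p 1 2 even_two).toKummerDataOfSection SemidirectProduct.inr (continuous_inrχq p 1 2)
        (fun _ => rfl) (map_inr_GK_le_GtpY_modelχq' p 1 2 even_two)
        (map_inr_GKdd_le_GtpYdd_modelχq' p 1 2 even_two)).etaleThetaDataOfClass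
        (etaDdχq p 1 2 even_two)).doubleUnderlineχqOfEtaRes p 1 2 l hl (eta_res_etaDdχq p 1 2 even_two l hl)
    let B := BadPlaceSetting.ofUnderline C μ (compat_modelχq p 1 2 even_two)
        (ThetaSetting.modelχq_sec2Hyps p 1 2 even_two) hlp (ne_two_of_four_mul_dvd_pred p l.pos hdvd)
        (ne_of_four_mul_dvd_pred p l.pos hdvd) (exists_isPrimitiveRoot_K_modelχq p 1 2 even_two l.pos hdvd)
        (EtaleThetaDataOfSetting.modN_rootLift_mem_thetaCocycles C (compat_modelχq p 1 2 even_two)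
          (ThetaSetting.modelχq_sec2Hyps p 1 2 even_two) μ)
    (∀ α : ↥C.Huu ≃ₜ* ↥C.Huu, ∀ g : ↥C.Huu, gfpSnd (g : PiTpχq p 1 2).left = 1 →
      (levelHom 2 ((α g : ↥C.Huu) : PiTpχq p 1 2).left).y = (levelHom 2 (g : PiTpχq p 1 2).left).y) →
      ∀ {P : TopGroup.{0}} (T₁ T₂ : TemperedCoverings B P), T₁.YL = T₂.YL ∧ T₁.YddL = T₂.YddL := by
  intro C B hLY P T₁ T₂
  exact YL_eq_of_piYddCharacteristic_modelTate p l hl hlp hdvd μ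
    (piYddCharacteristic_modelχq_of_parity p 1 2 even_two C hLY) T₁ T₂

end ModelTateCarriers

end Literature.IUT.HodgeArakelov
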